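import Summits.AnomalousDissipation.AnomalousDissipation.Theorems.EnsembleRigidityGPStatisticalRigidityLinearTestLimit
import Summits.AnomalousDissipation.AnomalousDissipation.Theorems.TameRoughRigidityGPEulerCoerciveStubGalerkinTail
import Literature.Analysis.FluidPDE.StatisticalSolutionEnergyEq
import HarnessLib

/-!
# Linear rungs of the enstrophy-floor ladder — crux `TameRoughRigidity.GPEulerCoercive`
  (stmt-AnomalousDissipation-18400), line `floor_duality_galerkin`, tools stub `stub_linearRungTools`

The crux N: no Borel probability measure on `H = L²_σ(T³)` is a stationary statistical solution of
EULER forced by `f_GP`. The line reduces N to an unbounded ladder of enstrophy floors. This file lands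
the RUNG-MAKER FOR LINEAR CERTIFICATES: a fixed smooth solenoidal mean-zero test field `w` certifies
the floor `∫ ‖∇v‖² dμ ≥ (f, w)` for EVERY stationary Euler statistics `μ` of `f` as soon as the
pointwise functional inequality

  `‖∇v‖² + ∫ (v ⊗ v) : ∇w ≥ 0`   at every finite-enstrophy `v ∈ H`            (⋆)

holds — because the stationary Liouville identity, passed to the fixed linear test `w` by the landed
cut-off removal `stub_linearTestLimit` (zero defect), says `∫ [ (f,w) + ∫ (v ⊗ v) : ∇w ] dμ = 0`.
And (⋆) follows from a FINITE-DIMENSIONAL certificate: by the landed Galerkin tail algebra of the line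
(`toReal_eGradNormSq_split`: `‖∇v‖² = ‖∇T_M v‖² + ‖∇(T_M v − v)‖²`, `‖∇z‖² ≥ λ_M|z|²`, and
`inertialPairing_sub_galerkinProj_ge`: the tail changes `∫ (v ⊗ v) : ∇w` by at least
`−(S²/(λ_M − S) |T_M v|² + λ_M |z|²)` when `|⟨∇w(x) e, e⟩| ≤ S|e|²`, `0 ≤ S < λ_M = 4π²(M²+1)`), it is
enough that

  `‖∇T_M v‖² − S²/(λ_M − S) · |T_M v|² + ∫ (P_M v ⊗ P_M v) : ∇w ≥ 0`   for all `v ∈ H`,       (⋆_M)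

a positive-semidefiniteness statement for ONE explicit Hermitian form in the finitely many Fourier
coefficients `{v̂(k) : 0 < |k| ≤ M}`. So every verified instance of (⋆_M) is a rung
"`every Euler statistics of f has mean enstrophy ≥ (f, w)`". The landed floor `3π`
(`stub_gpEulerFloorTools`) is the instance `w = 2π f_GP`, `M = 1` of this scheme up to the crude
pointwise bound; the lead's numerics (kit j026195: single-test caps `1.5 p*(M) = 13.85 (M = 2)`,
`17.54 (M = 3)` for `w = p f_GP`) say the scheme climbs well beyond the energy horizon of linear tests.

## Contents

* `inertialPairing_ge_neg_enstrophy_of_galerkinPSD` — (⋆_M) ⇒ (⋆).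
* `ensembleEnstrophy_ge_pairing_of_pointwise` — (⋆) ⇒ the floor `(f,w) ≤ ensembleEnstrophy μ`.
* `ensembleEnstrophy_ge_pairing_of_galerkinPSD` — the rung-maker (⋆_M) ⇒ floor.
* `stub_linearRungTools` — registered tools stub (conjunction).

## References

* C. Foias, O. Manley, R. Rosa, R. Temam, *Navier–Stokes Equations and Turbulence* (CUP 2001),
  Ch. IV §1.2 (1.30) (the Liouville identity) and (1.11).
* J. C. Robinson, J. L. Rodrigo, W. Sadowski, *The Three-Dimensional Navier–Stokes Equations*
  (CUP 2016), §4.1 Lemma 4.1 (Galerkin = Fourier truncation, tail estimates).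
-/

-- `Summit.<Summit>.<Problem>` is the tree's mandated summit-side namespace (CONVENTIONS §2); single-conjunct summit, duplicate deliberate.
set_option linter.dupNamespace false

noncomputable section

namespace Summit.AnomalousDissipation.AnomalousDissipation.Theorems.TameRoughRigidity.GPEulerCoercive

open MeasureTheory Filter Topology UnitAddTorus
open scoped InnerProductSpace RealInnerProductSpace ENNReal NNReal
open Literature.Analysis.FunctionSpaces Literature.Analysis.FluidPDE
open Summit.AnomalousDissipation.AnomalousDissipation.Theorems.EnsembleRigidity.GPStatisticalRigidity

/-- Local notation: real vector fields on `T³`. -/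
local notation "Vec3" => (UnitAddTorus (Fin 3)) → (EuclideanSpace ℝ (Fin 3))
/-- Local notation: `L²(T³; ℝ³)`. -/
local notation "L2" => (Lp (EuclideanSpace ℝ (Fin 3)) 2 (volume : Measure (UnitAddTorus (Fin 3))))
/-- Local notation: the energy space `H`. -/
local notation "H3" => (Torus.energySpace (Fin 3))

/-! ## (⋆_M) ⇒ (⋆): the tail is absorbed by the enstrophy -/

/-- **Finite Galerkin certificate ⇒ pointwise linear certificate.** Let `w` be smooth with pointwise
strain `|⟨∇w(x) e, e⟩| ≤ S|e|²`, `0 ≤ S < λ_M = 4π²(M²+1)`. If for every `v ∈ H`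
`‖∇T_M v‖² − S²/(λ_M − S)·|T_M v|² + ∫ (P_M v ⊗ P_M v) : ∇w ≥ 0` (a statement about the finitely many
Fourier coefficients of order `≤ M`), then `∫ (v ⊗ v) : ∇w ≥ −‖∇v‖²` at every finite-enstrophy `v ∈ H`
(spectral Pythagoras, tail gap, and the landed inertial tail estimate). [folklore] -/
theorem inertialPairing_ge_neg_enstrophy_of_galerkinPSD (w : Vec3) (hw : Torus.IsSmooth w)
    (M : ℕ) (S : ℝ)
    (hstrain : ∀ (x : UnitAddTorus (Fin 3)) (e : EuclideanSpace ℝ (Fin 3)),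
      |⟪Torus.fderiv w x e, e⟫_ℝ| ≤ S * ‖e‖ ^ 2)
    (hS : 0 ≤ S) (hSM : S < 4 * Real.pi ^ 2 * ((M : ℝ) ^ 2 + 1))
    (hpsd : ∀ v : H3,
      0 ≤ (Torus.eGradNormSq (Torus.fourierTruncate M ((v : L2) : Vec3))).toReal
        - S ^ 2 / (4 * Real.pi ^ 2 * ((M : ℝ) ^ 2 + 1) - S) *
            (∫ x, ‖Torus.fourierTruncate M ((v : L2) : Vec3) x‖ ^ 2)
        + Torus.inertialPairing ((Torus.galerkinProj M : L2 →L[ℝ] L2) (v : L2)) w)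
    (v : H3) (hfin : Torus.eGradNormSq ((v : L2) : Vec3) ≠ ⊤) :
    -(Torus.eGradNormSq ((v : L2) : Vec3)).toReal ≤ Torus.inertialPairing (v : L2) w := by
  have hu2 : MemLp ((v : L2) : Vec3) 2 volume := Lp.memLp (v : L2)
  obtain ⟨hGsplit, hgap⟩ := toReal_eGradNormSq_split hu2 hfin M
  have hin := inertialPairing_sub_galerkinProj_ge v.2 M hw hstrain hS hSM
  have hc := hpsd v
  have hGz : 0 ≤ (Torus.eGradNormSq (Torus.fourierTruncate M ((v : L2) : Vec3))).toReal :=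
    ENNReal.toReal_nonneg
  linarith [hGsplit, hgap, hin, hc, hGz]

/-! ## (⋆) ⇒ the floor -/

/-- **Pointwise linear certificate ⇒ enstrophy floor.** If `∫ (v ⊗ v) : ∇w ≥ −‖∇v‖²` at every
finite-enstrophy `v ∈ H` for a smooth solenoidal mean-zero `w` and `f ∈ L²`, then every stationary
Euler statistics `μ` of `f` has `∫ ‖∇v‖² dμ ≥ (f, w)`: the Liouville identity passes to the fixed
linear test (`stub_linearTestLimit` at zero defect), `∫ [(f,w) + ∫ (v ⊗ v) : ∇w] dμ = 0`, and the
certificate integrates (`μ`-a.e. finite enstrophy). [folklore] -/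
theorem ensembleEnstrophy_ge_pairing_of_pointwise (f w : Vec3) (hf : MemLp f 2 volume)
    (hw : Torus.IsSmooth w) (hdw : Torus.IsDivFree w) (hzw : Torus.HasZeroMean w)
    (hcert : ∀ v : H3, Torus.eGradNormSq ((v : L2) : Vec3) ≠ ⊤ →
      -(Torus.eGradNormSq ((v : L2) : Vec3)).toReal ≤ Torus.inertialPairing (v : L2) w)
    (μ : Measure H3) (hμ : Torus.IsStationaryStatisticalSolution 0 f μ) :
    ENNReal.ofReal (∫ x, ⟪f x, w x⟫_ℝ) ≤ Torus.ensembleEnstrophy μ := by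
  haveI := hμ.prob
  -- zero defect against every cylindrical test, hence against the fixed linear test `w`
  have hdef : ∀ Φ : Torus.CylindricalTest (Fin 3),
      Integrable (fun v : H3 => Torus.nsGeneratorPairing 0 f v (Φ.grad v)) μ ∧
        |∫ v, Torus.nsGeneratorPairing 0 f v (Φ.grad v) ∂μ| ≤
          0 * Real.sqrt (∫ v, Torus.gradNormSq (Φ.grad v) ∂μ) := by
    intro Φ
    obtain ⟨hI, h0⟩ := hμ.generator Φ
    refine ⟨hI, ?_⟩
    rw [h0, abs_zero, zero_mul]
  obtain ⟨hI, hle⟩ :=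
    stub_linearTestLimit f w hf hw hdw hzw μ hμ.prob hμ.integrable_norm_sq 0 hdef
  rw [zero_mul] at hle
  have h0 : ∫ v, Torus.nsGeneratorPairing 0 f v w ∂μ = 0 :=
    abs_eq_zero.1 (le_antisymm hle (abs_nonneg _))
  -- the generator against `w` is `(f,w) + inertialPairing v w`
  have hgen : ∀ v : H3, Torus.nsGeneratorPairing 0 f v w =
      (∫ x, ⟪f x, w x⟫_ℝ) + Torus.inertialPairing (v : L2) w := by
    intro v
    rw [Torus.nsGeneratorPairing, zero_mul, add_zero]
  have hII : Integrable (fun v : H3 => Torus.inertialPairing (v : L2) w) μ := by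
    have h := hI.sub (integrable_const (∫ x, ⟪f x, w x⟫_ℝ))
    refine h.congr (ae_of_all _ fun v => ?_)
    simp only [Pi.sub_apply, hgen]
    ring
  have hIint : ∫ v, Torus.inertialPairing (v : L2) w ∂μ = -(∫ x, ⟪f x, w x⟫_ℝ) := by
    have h1 : ∫ v, Torus.nsGeneratorPairing 0 f v w ∂μ =
        (∫ x, ⟪f x, w x⟫_ℝ) + ∫ v, Torus.inertialPairing (v : L2) w ∂μ := by
      simp_rw [hgen]
      rw [integral_add (integrable_const _) hII, integral_const, probReal_univ, one_smul]
    linarith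
  -- the enstrophy density
  have hGlt : ∀ᵐ u : H3 ∂μ, Torus.eGradNormSq ((u : L2) : Vec3) < ⊤ := hμ.ae_eGradNormSq_lt_top
  have haI : Integrable (fun u : H3 => (Torus.eGradNormSq ((u : L2) : Vec3)).toReal) μ :=
    hμ.integrable_toReal_eGradNormSq
  have hGa : ∫ u : H3, (Torus.eGradNormSq ((u : L2) : Vec3)).toReal ∂μ =
      (Torus.ensembleEnstrophy μ).toReal := by
    rw [Torus.ensembleEnstrophy,
      integral_toReal Torus.measurable_eGradNormSq_coe.aemeasurable hGlt]
  -- integrate the certificate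
  have hae : ∀ᵐ v : H3 ∂μ,
      -(Torus.eGradNormSq ((v : L2) : Vec3)).toReal ≤ Torus.inertialPairing (v : L2) w := by
    filter_upwards [hGlt] with v hv
    exact hcert v hv.ne
  have hnI : Integrable (fun u : H3 => -(Torus.eGradNormSq ((u : L2) : Vec3)).toReal) μ := haI.neg
  have hmono := integral_mono_ae hnI hII hae
  rw [integral_neg, hGa, hIint] at hmono
  exact ENNReal.ofReal_le_of_le_toReal (by linarith)

/-! ## The rung-maker -/

/-- **Linear rung from a finite Galerkin certificate.** For `f ∈ L²`, a smooth solenoidal mean-zero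
test field `w` with pointwise strain `≤ S`, `0 ≤ S < λ_M`, and the finite-dimensional certificate
(⋆_M) `‖∇T_M v‖² − S²/(λ_M − S)|T_M v|² + ∫ (P_M v ⊗ P_M v) : ∇w ≥ 0` on `H`, every stationary Euler
statistics `μ` of `f` has mean enstrophy `≥ (f, w)`. [folklore] -/
theorem ensembleEnstrophy_ge_pairing_of_galerkinPSD (f w : Vec3) (hf : MemLp f 2 volume)
    (hw : Torus.IsSmooth w) (hdw : Torus.IsDivFree w) (hzw : Torus.HasZeroMean w)
    (M : ℕ) (S : ℝ)
    (hstrain : ∀ (x : UnitAddTorus (Fin 3)) (e : EuclideanSpace ℝ (Fin 3)),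
      |⟪Torus.fderiv w x e, e⟫_ℝ| ≤ S * ‖e‖ ^ 2)
    (hS : 0 ≤ S) (hSM : S < 4 * Real.pi ^ 2 * ((M : ℝ) ^ 2 + 1))
    (hpsd : ∀ v : H3,
      0 ≤ (Torus.eGradNormSq (Torus.fourierTruncate M ((v : L2) : Vec3))).toReal
        - S ^ 2 / (4 * Real.pi ^ 2 * ((M : ℝ) ^ 2 + 1) - S) *
            (∫ x, ‖Torus.fourierTruncate M ((v : L2) : Vec3) x‖ ^ 2)
        + Torus.inertialPairing ((Torus.galerkinProj M : L2 →L[ℝ] L2) (v : L2)) w)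
    (μ : Measure H3) (hμ : Torus.IsStationaryStatisticalSolution 0 f μ) :
    ENNReal.ofReal (∫ x, ⟪f x, w x⟫_ℝ) ≤ Torus.ensembleEnstrophy μ :=
  ensembleEnstrophy_ge_pairing_of_pointwise f w hf hw hdw hzw
    (inertialPairing_ge_neg_enstrophy_of_galerkinPSD w hw M S hstrain hS hSM hpsd) μ hμ

/-! ## The registered tools stub -/

/-- **Tools stub `stub_linearRungTools`** (registered on stmt-AnomalousDissipation-18400, line
`floor_duality_galerkin`): the rung-maker for linear certificates — (i) a finite Galerkin certificate
(⋆_M) makes the pointwise inequality `∫ (v ⊗ v) : ∇w ≥ −‖∇v‖²` on `H`, and (ii) that inequality makes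
`(f, w)` an enstrophy floor of every stationary Euler statistics of `f`. [folklore] -/
theorem stub_linearRungTools :
    (∀ (w : Vec3), Torus.IsSmooth w → ∀ (M : ℕ) (S : ℝ), (∀ (x : UnitAddTorus (Fin 3)) (e : EuclideanSpace ℝ (Fin 3)), |⟪Torus.fderiv w x e, e⟫_ℝ| ≤ S * ‖e‖ ^ 2) → 0 ≤ S → S < 4 * Real.pi ^ 2 * ((M : ℝ) ^ 2 + 1) → (∀ v : H3, 0 ≤ (Torus.eGradNormSq (Torus.fourierTruncate M ((v : L2) : Vec3))).toReal - S ^ 2 / (4 * Real.pi ^ 2 * ((M : ℝ) ^ 2 + 1) - S) * (∫ x, ‖Torus.fourierTruncate M ((v : L2) : Vec3) x‖ ^ 2) + Torus.inertialPairing ((Torus.galerkinProj M : L2 →L[ℝ] L2) (v : L2)) w) → ∀ v : H3, Torus.eGradNormSq ((v : L2) : Vec3) ≠ ⊤ → -(Torus.eGradNormSq ((v : L2) : Vec3)).toReal ≤ Torus.inertialPairing (v : L2) w) ∧ (∀ (f w : Vec3), MemLp f 2 volume → Torus.IsSmooth w → Torus.IsDivFree w → Torus.HasZeroMean w → (∀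 v : H3, Torus.eGradNormSq ((v : L2) : Vec3) ≠ ⊤ → -(Torus.eGradNormSq ((v : L2) : Vec3)).toReal ≤ Torus.inertialPairing (v : L2) w) → ∀ μ : Measure H3, Torus.IsStationaryStatisticalSolution 0 f μ → ENNReal.ofReal (∫ x, ⟪f x, w x⟫_ℝ) ≤ Torus.ensembleEnstrophy μ) :=
  ⟨fun w hw M S hstrain hS hSM hpsd => inertialPairing_ge_neg_enstrophy_of_galerkinPSD w hw M S hstrain hS hSM hpsd,
    fun f w hf hw hdw hzw hcert μ hμ => ensembleEnstrophy_ge_pairing_of_pointwise f w hf hw hdw hzw hcert μ hμ⟩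

end Summit.AnomalousDissipation.AnomalousDissipation.Theorems.TameRoughRigidity.GPEulerCoercive

end
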